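import Summits.QuantumFields.YangMills.Theorems.UnitScaleTiltHalvingP1FlatCorePreGaugeWindows
import Literature.MathematicalPhysics.QuantumFieldTheory.Balaban1983to89.B8Thm4TruncationLocal
import Literature.MathematicalPhysics.QuantumFieldTheory.Balaban1983to89.B8Eq138LandauZd
import Literature.MathematicalPhysics.QuantumFieldTheory.Balaban1983to89.BlockAveragingExpMeanLog
import Summits.QuantumFields.YangMills.Theorems.UnitScaleTiltProp8FlatCubeSequenceAligned
import HarnessLib

/-!
# `hP1room` PROGRAMME (LEAD-H BOARD v2 ∕ RULING L-10), (A-1) STAGE 3 — THE J3 GLUE: rows [R-a] `hAchart` and [R-c] `hg` of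
# ✓`HalvingP1FlatCoreSupplierDoor.hSup_of_contentRows` (generic torus gauge), and the J3 instance with its windows and the input one-form `A`

Route `UnitScaleTilt`, crux K1 child «MinimiserStabilityRegPr» (stmt-QuantumFields-19200), registered stub `stub_halvingStep` (`BirthV10`), text
`H = hSupU` (✓`HalvingP1FlatCoreFamilyDoor.p1FlatPillar'_room_of_suppliers` ∘ ✓`hSup_of_contentRows`).  Cell `ym3-torus` (HUMAN RULING D-0037: YM₃ on
T³ is ladder rung R3 — NOT d = 4, NOT a mass gap, NOT the Clay problem), width seat `ym-ust-19200-w7` gen 5.  `--supports stmt-QuantumFields-19200 --as helper`;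
THEOREMS ONLY (0 `def`, 0 `sorry`); count-neutral; nothing here claims `hSupU`, `hP1room`, the stub, the crux or the gap.

WHAT IS PROVED.  Write `k := K − n`, `η := L^{−k}`, `U♭ := unitsField (toUField U)` (the member field read in `M₂(ℂ)ˣ`), and for a torus gauge
`g : Site → M₂(ℂ)ˣ` the charted iterate `W₁ := (U♭)^g = gaugeActT g U♭` with its `ℤ³` pullback `W₁♯ := pull W₁ 0` based at `0` (`W₁♯(z, ν) = W₁⟨0 + z, ν⟩`, rfl).
N05's top cube is `□̃^{(k)} = [tLo a ρ′, tHi a M′ ρ′] = [a − 2ρ′, a + M′ − 1 + 2ρ′]` ([Balaban1985RegularSpaces] p. 98); its depth-`k` blow-up `□̃` contains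
`□₀ = cube L a M′ ρ′ k 0` together with a collar of one bond (✓`B8Eq131Cubes.collar_cube`).
* §1 (GENERIC torus gauge ∕ generic `M₂(ℂ)ˣ`-valued torus field `W`, any `Params`; LEAD-H L-10 with ★w3-20520 g6's reshape — the door's `g` is the COMPOSITE
  `(u₁ ∘ rep)⁻¹·(toUnits ∘ suIncl ∘ g_{J3})` fixed by STAGE 3b, so the chart rows are stated for any `g`): at a bond with `‖W⟨0+z, ν⟩ − 1‖` small,
  `cfgExp_logCfg_pull` ([R-a] at one bond: `e^{iη·logCfg η W♯(z,ν)} = W⟨0+z, ν⟩`, `‖·−1‖ < 1`), `isSelfAdjoint_logCfg_pull` (unitary, `≤ 1∕3`),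
  `trace_logCfg_pull_eq_zero` (`det = 1`, `≤ 1∕3`), `eta_mul_norm_logCfg_pull_le` (`η‖logCfg η W♯(z,ν)‖ ≤ 2s` for `‖·−1‖ ≤ s ≤ 1∕2`); ★`exists_cutoff_oneForm`: for an
  `SU(2)`-valued `W` the one-form `A := 𝟙{‖W♯ − 1‖ ≤ 1∕4}·logCfg η W♯` is Hermitian and traceless EVERYWHERE with `η‖A‖ ≤ 1∕2` and agrees with `logCfg η W♯` (so
  `e^{iηA} = W`) at every bond within `1∕4` of `1` — this is how the GLOBAL `hAsa : ∀ x μ, IsSelfAdjoint (A x μ)` of ✓`P1FlatCoreTopStepTorus.hFP_kLevel_top_RD` is met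
  by a field that is near `1` only on a window; ★★`hAchart_of_near`: the door's row [R-a] VERBATIM (its two `cubeSetM` premises included) for ANY `g` and
  `A := logCfg η (pull (U♭)^g 0)`, from `‖(U♭)^g − 1‖ < 1` on the same window bonds.
* §2 (the J3 INSTANCE, `u₁ = 1`): ★★★ `exists_preGauge_chart` — for `U ∈ 𝔘_k(ε₀)` (`RegPr F n K ε₀ U`, [Balaban1985Variational] (2)) under the standing smallness
  `10⁷L³ε₀ ≤ 1`, the (1.65)-descent window `22d²ε₀ + 4·l1(tHi − tLo)·ε₀ ≤ 1∕6` and the no-wrap clause `tHi − tLo < sitesPerDir k` of □̃^{(k)}, and a prescribed top frame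
  `c₀ ∈ SU(2)`, there are a torus gauge `g := toUnits ∘ suIncl ∘ g_{J3}` and a one-form `A` (the cutoff one-form of `W₁`) with: [R-c] `hg : ∀ s, ↑(g s) ∈ SU(2)`; `W₁` is
  `SU(2)`-valued; J3's rows (a) `W₁♯ ∈ 𝔄_k(ε₀)`, (a′) the top values of `g♯` on □̃^{(k)}, (b) (1.15) at every block between all consecutive levels, (b′) `W₁♯ ∈ Ax_m(ℭ, 1)`,
  (c′)(c) the top average in the tree gauge of □̃^{(k)}, (d) (1.66) at background `1` on the whole tower below □̃^{(k)} (`hW1near` at every depth `m ≤ k`) — all VERBATIM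
  from ✓`P1FlatCorePreGauge.exists_preGauge_flat` at the top box □̃^{(k)}, read through `(U^{g_{J3}})♭ = (U♭)^{g}` (✓`T3PrintedRegularOrbits.toUField_gaugeAct` ∘
  ✓`B10Eq68TorusRegularity.unitsField_gaugeAct`); the GLOBAL one-form rows (Hermitian, traceless, `η‖A‖ ≤ 1∕2`); on every fine bond `(x, ν)` of □̃ (`tlo L tLo k ≤ x`,
  `x + e_ν ≤ thi L tHi k`): `A(x, ν) = logCfg η W₁♯ (x, ν)`, [R-a] `e^{iηA(x,ν)} = W₁⟨0 + x, ν⟩`, `η‖A(x, ν)‖ ≤ 2·(22d²ε₀ + 4·l1·ε₀)`, `‖W₁⟨0+x, ν⟩ − 1‖ < 22d²ε₀ + 4·l1·ε₀`;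
  and the same four rows for every `z ∈ □₀` and every direction at both bonds `(z, ν)` and `(z − e_ν, ν)` (the door's [R-a] binder with its two `cubeSetM` premises
  ignored: `fun z hz ν _ _ => (h z hz ν).1.2.1`).  `exists_preGauge_chart_of_ten7`: the same with the descent window discharged from `l1(tHi − tLo) ≤ 10⁵` (✓`preGauge_windows`).
HONEST SCOPE: bookkeeping on landed J3 + the series logarithm (✓`MatrixLog.exp_mlog`, ✓`ExpMeanLog.star_mlog_eq_neg`∕`trace_mlog_eq_zero_of_det_eq_one`, ✓`collar_cube`);
nothing of Theorem 4 ∕ Proposition 5 ∕ Theorem 2 is proved; the analytic content of `hSupU` stays in rows [R-b], [R-d]–[R-h]; the composite-`g` instance rides with STAGE 3b.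
References: T. Bałaban, CMP **99** (1985) 75–102 [Balaban1985RegularSpaces] ((1.33)–(1.36) p.82, (1.65)–(1.66) p.87, Thm 4 p.88, (1.69) p.88, p.98); CMP **98** (1985)
17–51 [Balaban1985Averaging] ((8) p.19, (21)–(23) p.21, Prop. 2 (52)–(54) p.26); CMP **102** (1985) 277–309 [Balaban1985Variational] ((2) p.278, (144)–(147) p.300, (152) p.301).
-/

set_option autoImplicit false

noncomputable section

open scoped Matrix.Norms.L2Operator

namespace Summit.QuantumFields.YangMills.Theorems.HalvingP1FlatCoreSupplierPreGauge

open NormedSpace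
open Complex (I I_ne_zero)
open Literature.MathematicalPhysics.QuantumFieldTheory.Balaban1983to89
open Literature.MathematicalPhysics.QuantumFieldTheory.Balaban1983to89.T3ContinuumYM3Torus
open MatrixLog (mlog exp_mlog norm_mlog_le_two_mul)
open Literature.MathematicalPhysics.QuantumFieldTheory.Balaban1983to89.T3PrintedRegularMinimiser (RegPr)
open B7Prop1Explicit renaming Site → LSite
open B7Prop1Explicit (gaugeAct axialFn boxVec e l1 expUnit val_expUnit U1)
open B7Prop1Local (InBox)
open B7Prop2Explicit (avgIter avgIter_zero unitaryUnits mem_unitaryUnits)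
open B7Prop2SpecialUnitary (specialUnitaryUnits mem_specialUnitaryUnits)
open B8Ineq130 (tlo thi)
open B8Ineq132 (InAk Collar)
open B8Eq119TwistedAxial (InAx)
open B8Lemma1NonAbelian (lowPart)
open B8Eq131Cubes (cube tLo tHi collar_cube)
open B8Eq184Proof (cfgExp)
open B8Eq138LandauZd (logCfg)
open B10Eq27TorusAxialLog (transl pull pull_apply unitsField toUField suIncl gaugeActT gaugeActT_apply val_unitsField val_suIncl
  unitsField_mem_unitaryUnits)
open B8Thm2SetupTorus (pullGauge toUGauge)
open B8Thm4TruncationLocal (base_datum)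
open ExpMeanLog (star_mlog_eq_neg trace_mlog_eq_zero_of_det_eq_one)
open Summit.QuantumFields.YangMills.Theorems.FlatCubeSequenceAligned (cubeSetM)
open Summit.QuantumFields.YangMills.Theorems.P1FlatCorePreGauge (exists_preGauge_flat preGauge_windows)

/-! ## §1 GENERIC torus gauge ∕ generic charted field: the four chart rows of `A := logCfg η W♯` at a near-`1` bond, the door's [R-a], the cutoff one-form -/

section Generic

variable {P : Params}

/-- **[R-a] AT ONE BOND, ANY FIELD**: `e^{iη·logCfg η W♯(z,ν)} = W⟨0 + z, ν⟩` whenever `‖W⟨0+z, ν⟩ − 1‖ < 1` (`W♯ := pull W 0`; the series logarithm inverts `exp`).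
[cite: Balaban1985RegularSpaces, (1.36) p.82, (1.69) p.88; Balaban1985Averaging, (21)-(22) p.21] -/
theorem cfgExp_logCfg_pull {η : ℝ} (hη : η ≠ 0) (W : GaugeField P 0 (Matrix (Fin 2) (Fin 2) ℂ)ˣ) (z : LSite P.d) (ν : Fin P.d)
    (hnear : ‖((W ⟨transl 0 z, ν⟩ : (Matrix (Fin 2) (Fin 2) ℂ)ˣ) : Matrix (Fin 2) (Fin 2) ℂ) - 1‖ < 1) :
    cfgExp η (logCfg η (pull W 0)) z ν = W ⟨transl 0 z, ν⟩ := by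
  apply Units.ext
  rw [cfgExp, val_expUnit, logCfg, pull_apply]
  have harg : (I : ℂ) • (η • (η⁻¹ • ((I⁻¹ : ℂ) • mlog ((W ⟨transl 0 z, ν⟩ : (Matrix (Fin 2) (Fin 2) ℂ)ˣ) : Matrix (Fin 2) (Fin 2) ℂ)))) =
      mlog ((W ⟨transl 0 z, ν⟩ : (Matrix (Fin 2) (Fin 2) ℂ)ˣ) : Matrix (Fin 2) (Fin 2) ℂ) := by
    rw [smul_smul η η⁻¹, mul_inv_cancel₀ hη, one_smul, smul_smul, mul_inv_cancel₀ I_ne_zero, one_smul]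
  rw [harg]
  exact exp_mlog hnear

/-- **`A := logCfg η W♯` IS HERMITIAN AT A UNITARY NEAR-`1` BOND** (`(log W)* = −log W`, `(i⁻¹)* = −i⁻¹`). [cite: Balaban1985Averaging, (23) p.21; Balaban1985RegularSpaces, (1.36) p.82] -/
theorem isSelfAdjoint_logCfg_pull (η : ℝ) (W : GaugeField P 0 (Matrix (Fin 2) (Fin 2) ℂ)ˣ) (z : LSite P.d) (ν : Fin P.d)
    (hWu : ((W ⟨transl 0 z, ν⟩ : (Matrix (Fin 2) (Fin 2) ℂ)ˣ) : Matrix (Fin 2) (Fin 2) ℂ) ∈ Matrix.unitaryGroup (Fin 2) ℂ)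
    (hnear : ‖((W ⟨transl 0 z, ν⟩ : (Matrix (Fin 2) (Fin 2) ℂ)ˣ) : Matrix (Fin 2) (Fin 2) ℂ) - 1‖ ≤ 1 / 3) :
    IsSelfAdjoint (logCfg η (pull W 0) z ν) := by
  rw [logCfg, pull_apply]
  show star (η⁻¹ • ((I⁻¹ : ℂ) • mlog ((W ⟨transl 0 z, ν⟩ : (Matrix (Fin 2) (Fin 2) ℂ)ˣ) : Matrix (Fin 2) (Fin 2) ℂ))) = _
  rw [star_smul, star_smul, star_mlog_eq_neg hWu hnear, Complex.inv_I, Complex.star_def, map_neg, Complex.conj_I, neg_neg, smul_neg, neg_smul,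
    star_trivial]

/-- **`A := logCfg η W♯` IS TRACELESS AT A `det = 1` NEAR-`1` BOND** (Liouville: `e^{tr log W} = det W = 1`, `|tr log W| < 2π`).
[cite: Balaban1985Averaging, (20) p.21, (26) p.22; Balaban1985Variational, (152) p.301] -/
theorem trace_logCfg_pull_eq_zero (η : ℝ) (W : GaugeField P 0 (Matrix (Fin 2) (Fin 2) ℂ)ˣ) (z : LSite P.d) (ν : Fin P.d)
    (hdet : (((W ⟨transl 0 z, ν⟩ : (Matrix (Fin 2) (Fin 2) ℂ)ˣ) : Matrix (Fin 2) (Fin 2) ℂ)).det = 1)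
    (hnear : ‖((W ⟨transl 0 z, ν⟩ : (Matrix (Fin 2) (Fin 2) ℂ)ˣ) : Matrix (Fin 2) (Fin 2) ℂ) - 1‖ ≤ 1 / 3) :
    (logCfg η (pull W 0) z ν).trace = 0 := by
  rw [logCfg, pull_apply, Matrix.trace_smul, Matrix.trace_smul, trace_mlog_eq_zero_of_det_eq_one hdet hnear ?_, smul_zero, smul_zero]
  have hπ : (2 : ℝ) / 3 < Real.pi := by linarith [Real.pi_gt_three]
  refine lt_of_le_of_lt ?_ hπ
  rw [Fintype.card_fin]
  push_cast
  linarith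

/-- **THE (1.36)-SIZE OF `A := logCfg η W♯` AT A NEAR-`1` BOND**: `η‖A(z,ν)‖ ≤ 2‖W − 1‖ ≤ 2s` (`‖log W‖ ≤ 2‖W − 1‖` for `‖W − 1‖ ≤ 1∕2`).
[cite: Balaban1985RegularSpaces, (1.36) p.82, (1.69) p.88; Balaban1985Averaging, (26) p.22] -/
theorem eta_mul_norm_logCfg_pull_le {η : ℝ} (hη : 0 < η) (W : GaugeField P 0 (Matrix (Fin 2) (Fin 2) ℂ)ˣ) (z : LSite P.d) (ν : Fin P.d)
    {s : ℝ} (hs : s ≤ 1 / 2) (hnear : ‖((W ⟨transl 0 z, ν⟩ : (Matrix (Fin 2) (Fin 2) ℂ)ˣ) : Matrix (Fin 2) (Fin 2) ℂ) - 1‖ ≤ s) :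
    η * ‖logCfg η (pull W 0) z ν‖ ≤ 2 * s := by
  rw [logCfg, pull_apply, norm_smul, norm_smul, norm_inv, norm_inv, Complex.norm_I, inv_one, one_mul, Real.norm_eq_abs, abs_of_pos hη,
    ← mul_assoc, mul_inv_cancel₀ hη.ne', one_mul]
  exact (norm_mlog_le_two_mul (hnear.trans hs)).trans (by linarith)

/-- **THE CUTOFF ONE-FORM** of a special-unitary torus field `W` (any torus gauge of an `SU(2)` field): `A := 𝟙{‖W♯ − 1‖ ≤ 1∕4}·logCfg η W♯` is Hermitian and
traceless EVERYWHERE with `η‖A‖ ≤ 1∕2`, and AGREES with `logCfg η W♯` — hence satisfies [R-a] `e^{iηA} = W` — at every bond within `1∕4` of `1` (the global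
`hAsa : ∀ x μ, IsSelfAdjoint (A x μ)` of ✓`P1FlatCoreTopStepTorus.hFP_kLevel_top_RD` is then free). [cite: Balaban1985RegularSpaces, (1.36) p.82, (1.69) p.88; Balaban1985Averaging, (21)-(23) p.21] -/
theorem exists_cutoff_oneForm {η : ℝ} (hη : 0 < η) (W : GaugeField P 0 (Matrix (Fin 2) (Fin 2) ℂ)ˣ)
    (hWsu : ∀ b : PBond P 0, ((W b : (Matrix (Fin 2) (Fin 2) ℂ)ˣ) : Matrix (Fin 2) (Fin 2) ℂ) ∈ Matrix.specialUnitaryGroup (Fin 2) ℂ) :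
    ∃ A : LSite P.d → Fin P.d → Matrix (Fin 2) (Fin 2) ℂ,
      (∀ x ν, IsSelfAdjoint (A x ν)) ∧ (∀ x ν, (A x ν).trace = 0) ∧ (∀ x ν, η * ‖A x ν‖ ≤ 1 / 2) ∧
      ∀ x ν, ‖((W ⟨transl 0 x, ν⟩ : (Matrix (Fin 2) (Fin 2) ℂ)ˣ) : Matrix (Fin 2) (Fin 2) ℂ) - 1‖ ≤ 1 / 4 →
        A x ν = logCfg η (pull W 0) x ν ∧ cfgExp η A x ν = W ⟨transl 0 x, ν⟩ := by
  classical
  refine ⟨fun x ν => if ‖((W ⟨transl 0 x, ν⟩ : (Matrix (Fin 2) (Fin 2) ℂ)ˣ) : Matrix (Fin 2) (Fin 2) ℂ) - 1‖ ≤ 1 / 4 then logCfg η (pull W 0) x ν else 0,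
    fun x ν => ?_, fun x ν => ?_, fun x ν => ?_, fun x ν hb => ?_⟩
  · dsimp only
    by_cases hb : ‖((W ⟨transl 0 x, ν⟩ : (Matrix (Fin 2) (Fin 2) ℂ)ˣ) : Matrix (Fin 2) (Fin 2) ℂ) - 1‖ ≤ 1 / 4
    · rw [if_pos hb]
      exact isSelfAdjoint_logCfg_pull η W x ν (Matrix.specialUnitaryGroup_le_unitaryGroup (hWsu _)) (hb.trans (by norm_num))
    · rw [if_neg hb]
      exact IsSelfAdjoint.zero _
  · dsimp only
    by_cases hb : ‖((W ⟨transl 0 x, ν⟩ : (Matrix (Fin 2) (Fin 2) ℂ)ˣ) : Matrix (Fin 2) (Fin 2) ℂ) - 1‖ ≤ 1 / 4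
    · rw [if_pos hb]
      exact trace_logCfg_pull_eq_zero η W x ν (Matrix.mem_specialUnitaryGroup_iff.1 (hWsu _)).2 (hb.trans (by norm_num))
    · rw [if_neg hb, Matrix.trace_zero]
  · dsimp only
    by_cases hb : ‖((W ⟨transl 0 x, ν⟩ : (Matrix (Fin 2) (Fin 2) ℂ)ˣ) : Matrix (Fin 2) (Fin 2) ℂ) - 1‖ ≤ 1 / 4
    · rw [if_pos hb]
      have h := eta_mul_norm_logCfg_pull_le hη W x ν (by norm_num) hb
      linarith
    · rw [if_neg hb, norm_zero, mul_zero]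
      norm_num
  · dsimp only
    have hA : (if ‖((W ⟨transl 0 x, ν⟩ : (Matrix (Fin 2) (Fin 2) ℂ)ˣ) : Matrix (Fin 2) (Fin 2) ℂ) - 1‖ ≤ 1 / 4 then logCfg η (pull W 0) x ν else 0) =
        logCfg η (pull W 0) x ν := if_pos hb
    refine ⟨hA, ?_⟩
    have h := cfgExp_logCfg_pull hη.ne' W x ν (hb.trans_lt (by norm_num))
    rw [cfgExp] at h ⊢
    rw [hA]
    rw [logCfg] at h ⊢
    exact h

end Generic

section DoorShape

variable (F : T3Family) {n K : ℕ}

/-- ★★ **THE DOOR's [R-a] FOR A GENERIC TORUS GAUGE** (LEAD-H L-10 ∕ ★w3-20520 g6's reshape): for ANY `g : Site → M₂(ℂ)ˣ` — e.g. the composite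
`(u₁ ∘ rep)⁻¹·(toUnits ∘ suIncl ∘ g_{J3})` of STAGE 3b — and `A := logCfg η (pull (U♭)^g 0)`, the row `hAchart` of ✓`HalvingP1FlatCoreSupplierDoor.hSup_of_contentRows`
VERBATIM, from the near-`1` of `(U♭)^g` on the same window bonds. [cite: Balaban1985RegularSpaces, (1.36) p.82, (1.69) p.88; Balaban1985Averaging, (8) p.19, (21)-(22) p.21] -/
theorem hAchart_of_near (x₀ : Site (F.P K) 0) (ρ S M : ℕ) (a : LSite (F.P K).d) (M' ρ' : ℕ)
    (U : GaugeField (F.P K) 0 (Matrix.specialUnitaryGroup (Fin 2) ℂ)) (g : GaugeTransf (F.P K) 0 (Matrix (Fin 2) (Fin 2) ℂ)ˣ)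
    (hnear1 : ∀ z ∈ cube (F.P K).L a M' ρ' (K - n) 0, ∀ ν' : Fin (F.P K).d,
      transl (0 : Site (F.P K) 0) z ∈ cubeSetM x₀ (K - n) ρ S M 0 → (transl (0 : Site (F.P K) 0) z).shift ν' ∈ cubeSetM x₀ (K - n) ρ S M 0 →
      ‖((gaugeActT g (unitsField (toUField U)) ⟨transl 0 z, ν'⟩ : (Matrix (Fin 2) (Fin 2) ℂ)ˣ) : Matrix (Fin 2) (Fin 2) ℂ) - 1‖ < 1) :
    ∀ z ∈ cube (F.P K).L a M' ρ' (K - n) 0, ∀ ν' : Fin (F.P K).d,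
      transl (0 : Site (F.P K) 0) z ∈ cubeSetM x₀ (K - n) ρ S M 0 → (transl (0 : Site (F.P K) 0) z).shift ν' ∈ cubeSetM x₀ (K - n) ρ S M 0 →
      cfgExp (((F.L : ℝ)⁻¹) ^ (K - n)) (logCfg (((F.L : ℝ)⁻¹) ^ (K - n)) (pull (gaugeActT g (unitsField (toUField U))) 0)) z ν' =
        gaugeActT g (unitsField (toUField U)) ⟨transl 0 z, ν'⟩ := by
  intro z hz ν' hs1 hs2
  have hL0 : (F.L : ℝ) ≠ 0 := Nat.cast_ne_zero.2 (F.P K).L_pos.ne'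
  exact cfgExp_logCfg_pull (pow_ne_zero _ (inv_ne_zero hL0)) _ z ν' (hnear1 z hz ν' hs1 hs2)

end DoorShape

/-! ## §2 ★★★ The J3 instance (`u₁ = 1`): the pre-gauge chart — [R-c], J3's rows, the cutoff one-form with [R-a] -/

section Chart

variable (F : T3Family) {n K : ℕ}

/-- ★★★ **THE PRE-GAUGE CHART OF A PRINTED-REGULAR FIELD AT N05's TOP CUBE □̃^{(k)} — rows [R-c] `hg` and [R-a] `hAchart` of ✓`hSup_of_contentRows`, J3's rows
VERBATIM in the `W₁ := (U♭)^g` letters, and the input one-form `A` (Hermitian, traceless, `= (iη)⁻¹ log W₁♯` on the fine territory of □̃, [R-a] there and on □₀).**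
See the module docstring. [cite: Balaban1985RegularSpaces, (1.33)-(1.36) p.82, (1.65)-(1.66) p.87, Thm 4 p.88, p.98; Balaban1985Variational, (2) p.278, (144)-(147) p.300, (152) p.301; Balaban1985Averaging, (8) p.19, (21)-(23) p.21, Prop. 2 (54) p.26] -/
theorem exists_preGauge_chart (hnK : n < K) {ε₀ : ℝ} (hε₀ : 0 < ε₀) (hε : 10 ^ 7 * (F.L : ℝ) ^ 3 * ε₀ ≤ 1)
    {U : GaugeField (F.P K) 0 (Matrix.specialUnitaryGroup (Fin 2) ℂ)} (hU : RegPr F n K ε₀ U)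
    (a : LSite (F.P K).d) (M' ρ' : ℕ) (hρ' : 1 ≤ ρ')
    (hwrap : ∀ i, tHi a M' ρ' i - tLo a ρ' i < ((F.P K).sitesPerDir (K - n) : ℤ))
    (hsmall : 11 * ((F.P K).d : ℝ) ^ 2 * (2 * ε₀) + l1 (tHi a M' ρ' - tLo a ρ') * (2 * (2 * ε₀)) ≤ 1 / 6)
    (c₀ : (Matrix (Fin 2) (Fin 2) ℂ)ˣ) (hc₀ : c₀ ∈ specialUnitaryUnits (Fin 2)) :
    ∃ (g : GaugeTransf (F.P K) 0 (Matrix (Fin 2) (Fin 2) ℂ)ˣ) (A : LSite (F.P K).d → Fin (F.P K).d → Matrix (Fin 2) (Fin 2) ℂ),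
      -- [R-c] the pre-gauge is special unitary, and so is the charted iterate
      (∀ s : Site (F.P K) 0, ((g s : (Matrix (Fin 2) (Fin 2) ℂ)ˣ) : Matrix (Fin 2) (Fin 2) ℂ) ∈ Matrix.specialUnitaryGroup (Fin 2) ℂ) ∧
      (∀ b : PBond (F.P K) 0, ((gaugeActT g (unitsField (toUField U)) b : (Matrix (Fin 2) (Fin 2) ℂ)ˣ) : Matrix (Fin 2) (Fin 2) ℂ) ∈
        Matrix.specialUnitaryGroup (Fin 2) ℂ) ∧
      -- J3 (a): `W₁♯ ∈ 𝔄_k(ε₀)` on all of `ℤ³`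
      InAk (F.P K).L (K - n) (((F.L : ℝ)⁻¹) ^ (K - n)) ε₀ (fun _ => (Set.univ : Set (LSite (F.P K).d)))
        (pull (gaugeActT g (unitsField (toUField U))) 0) ∧
      -- J3 (a′): the top values of `g♯` on □̃^{(k)}
      (∀ z : LSite (F.P K).d, tLo a ρ' ≤ z → z ≤ tHi a M' ρ' →
        pullGauge g 0 ((((F.P K).L : ℤ) ^ (K - n)) • z) =
          c₀ * axialFn (avgIter (F.P K).L (pull (unitsField (toUField U)) 0) (K - n)) (tLo a ρ') z) ∧
      -- J3 (b): (1.15) between all consecutive levels at every block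
      (∀ m, m < K - n → ∀ (z : LSite (F.P K).d) (r : Fin (F.P K).d → Fin (F.P K).L),
        axialFn (avgIter (F.P K).L (pull (gaugeActT g (unitsField (toUField U))) 0) (K - n - (m + 1)))
          (((F.P K).L : ℤ) • z) (((F.P K).L : ℤ) • z + boxVec (F.P K).L r) = 1) ∧
      -- J3 (b′): `W₁♯ ∈ Ax_m(ℭ, 1)` for every `m ≤ k` and every family
      (∀ m, m ≤ K - n → ∀ Λ : ℕ → Set (LSite (F.P K).d),
        InAx (F.P K).L m Λ (1 : LSite (F.P K).d → Fin (F.P K).d → (Matrix (Fin 2) (Fin 2) ℂ)ˣ) (pull (gaugeActT g (unitsField (toUField U))) 0)) ∧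
      -- J3 (c′): the top average is `1` on the tree bonds of □̃^{(k)}
      (∀ (x : LSite (F.P K).d) (ν : Fin (F.P K).d), tLo a ρ' ≤ x → x + e ν ≤ tHi a M' ρ' → lowPart ν (x - tLo a ρ') = 0 →
        avgIter (F.P K).L (pull (gaugeActT g (unitsField (toUField U))) 0) (K - n) x ν = 1) ∧
      -- J3 (c): the top average is near `1` on □̃^{(k)}
      (∀ (x : LSite (F.P K).d) (ν : Fin (F.P K).d), tLo a ρ' ≤ x → x + e ν ≤ tHi a M' ρ' →
        ‖((avgIter (F.P K).L (pull (gaugeActT g (unitsField (toUField U))) 0) (K - n) x ν : (Matrix (Fin 2) (Fin 2) ℂ)ˣ) :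
            Matrix (Fin 2) (Fin 2) ℂ) - 1‖ ≤ l1 (tHi a M' ρ' - tLo a ρ') * (2 * (2 * ε₀))) ∧
      -- J3 (d): (1.66) at background `1` on the whole tower below □̃^{(k)}
      (∀ m, m ≤ K - n → ∀ (x : LSite (F.P K).d) (ν : Fin (F.P K).d), tlo (F.P K).L (tLo a ρ') m ≤ x → x + e ν ≤ thi (F.P K).L (tHi a M' ρ') m →
        ‖((avgIter (F.P K).L (pull (gaugeActT g (unitsField (toUField U))) 0) (K - n - m) x ν : (Matrix (Fin 2) (Fin 2) ℂ)ˣ) :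
            Matrix (Fin 2) (Fin 2) ℂ) - 1‖ < 11 * ((F.P K).d : ℝ) ^ 2 * (2 * ε₀) + l1 (tHi a M' ρ' - tLo a ρ') * (2 * (2 * ε₀))) ∧
      -- the input one-form, GLOBAL rows: Hermitian, traceless, `η‖A‖ ≤ 1∕2`
      (∀ (x : LSite (F.P K).d) (ν : Fin (F.P K).d), IsSelfAdjoint (A x ν)) ∧
      (∀ (x : LSite (F.P K).d) (ν : Fin (F.P K).d), (A x ν).trace = 0) ∧
      (∀ (x : LSite (F.P K).d) (ν : Fin (F.P K).d), ((F.L : ℝ)⁻¹) ^ (K - n) * ‖A x ν‖ ≤ 1 / 2) ∧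
      -- the input one-form on the fine territory of □̃: `A = logCfg η W₁♯`, [R-a] `e^{iηA} = W₁`, the (1.36)-size, the fine near-`1`
      (∀ (x : LSite (F.P K).d) (ν : Fin (F.P K).d), tlo (F.P K).L (tLo a ρ') (K - n) ≤ x → x + e ν ≤ thi (F.P K).L (tHi a M' ρ') (K - n) →
        A x ν = logCfg (((F.L : ℝ)⁻¹) ^ (K - n)) (pull (gaugeActT g (unitsField (toUField U))) 0) x ν ∧
        cfgExp (((F.L : ℝ)⁻¹) ^ (K - n)) A x ν = gaugeActT g (unitsField (toUField U)) ⟨transl 0 x, ν⟩ ∧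
        ((F.L : ℝ)⁻¹) ^ (K - n) * ‖A x ν‖ ≤ 2 * (11 * ((F.P K).d : ℝ) ^ 2 * (2 * ε₀) + l1 (tHi a M' ρ' - tLo a ρ') * (2 * (2 * ε₀))) ∧
        ‖((gaugeActT g (unitsField (toUField U)) ⟨transl 0 x, ν⟩ : (Matrix (Fin 2) (Fin 2) ℂ)ˣ) : Matrix (Fin 2) (Fin 2) ℂ) - 1‖ <
          11 * ((F.P K).d : ℝ) ^ 2 * (2 * ε₀) + l1 (tHi a M' ρ' - tLo a ρ') * (2 * (2 * ε₀))) ∧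
      -- the same four rows on □₀ = `cube L a M′ ρ′ k 0`, for both bonds `(z, ν)` and `(z − e_ν, ν)` ([R-a] is the second row at `(z, ν)`)
      (∀ z ∈ cube (F.P K).L a M' ρ' (K - n) 0, ∀ ν : Fin (F.P K).d,
        (A z ν = logCfg (((F.L : ℝ)⁻¹) ^ (K - n)) (pull (gaugeActT g (unitsField (toUField U))) 0) z ν ∧
          cfgExp (((F.L : ℝ)⁻¹) ^ (K - n)) A z ν = gaugeActT g (unitsField (toUField U)) ⟨transl 0 z, ν⟩ ∧
          ((F.L : ℝ)⁻¹) ^ (K - n) * ‖A z ν‖ ≤ 2 * (11 * ((F.P K).d : ℝ) ^ 2 * (2 * ε₀) + l1 (tHi a M' ρ' - tLo a ρ') * (2 * (2 * ε₀))) ∧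
          ‖((gaugeActT g (unitsField (toUField U)) ⟨transl 0 z, ν⟩ : (Matrix (Fin 2) (Fin 2) ℂ)ˣ) : Matrix (Fin 2) (Fin 2) ℂ) - 1‖ <
            11 * ((F.P K).d : ℝ) ^ 2 * (2 * ε₀) + l1 (tHi a M' ρ' - tLo a ρ') * (2 * (2 * ε₀))) ∧
        (A (z - e ν) ν = logCfg (((F.L : ℝ)⁻¹) ^ (K - n)) (pull (gaugeActT g (unitsField (toUField U))) 0) (z - e ν) ν ∧
          cfgExp (((F.L : ℝ)⁻¹) ^ (K - n)) A (z - e ν) ν = gaugeActT g (unitsField (toUField U)) ⟨transl 0 (z - e ν), ν⟩ ∧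
          ((F.L : ℝ)⁻¹) ^ (K - n) * ‖A (z - e ν) ν‖ ≤ 2 * (11 * ((F.P K).d : ℝ) ^ 2 * (2 * ε₀) + l1 (tHi a M' ρ' - tLo a ρ') * (2 * (2 * ε₀))) ∧
          ‖((gaugeActT g (unitsField (toUField U)) ⟨transl 0 (z - e ν), ν⟩ : (Matrix (Fin 2) (Fin 2) ℂ)ˣ) : Matrix (Fin 2) (Fin 2) ℂ) - 1‖ <
            11 * ((F.P K).d : ℝ) ^ 2 * (2 * ε₀) + l1 (tHi a M' ρ' - tLo a ρ') * (2 * (2 * ε₀)))) := by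
  classical
  have hk : K - n ≤ (F.P K).m + (F.P K).K := by show K - n ≤ F.m + K; omega
  have hL2 : 2 ≤ (F.P K).L := (F.P K).hL.2
  have hL0 : (F.L : ℝ) ≠ 0 := Nat.cast_ne_zero.2 (F.P K).L_pos.ne'
  set η : ℝ := ((F.L : ℝ)⁻¹) ^ (K - n) with hηdef
  have hη : 0 < η := pow_pos (inv_pos.2 (Nat.cast_pos.2 (F.P K).L_pos)) _
  set lo : LSite (F.P K).d := tLo a ρ' with hlo
  set hi : LSite (F.P K).d := tHi a M' ρ' with hhi
  set s₀ : ℝ := 11 * ((F.P K).d : ℝ) ^ 2 * (2 * ε₀) + l1 (hi - lo) * (2 * (2 * ε₀)) with hs₀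
  have hs₀4 : s₀ ≤ 1 / 4 := hsmall.trans (by norm_num)
  obtain ⟨hε3, hε2, -⟩ := preGauge_windows F (K := K) hε₀.le hε (B := 0) (by norm_num)
  -- J3 at the top box □̃^{(k)}
  obtain ⟨gJ, hInAk, htopval, h15, hInAx, htree, htopb, htower⟩ :=
    exists_preGauge_flat F hnK hε₀ hε3 hε2 hU lo hi hwrap hsmall c₀ hc₀
  set g : GaugeTransf (F.P K) 0 (Matrix (Fin 2) (Fin 2) ℂ)ˣ := fun x => Unitary.toUnits (suIncl (gJ x)) with hg
  -- `(U^{gJ})♭ = (U♭)^{g}` (✓`HalvingCompetitorMapFibre.unitsField_toUField_gaugeAct`, two rewrites)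
  have hbridge : unitsField (toUField (GaugeField.gaugeAct gJ U)) = gaugeActT g (unitsField (toUField U)) := by
    rw [T3PrintedRegularOrbits.toUField_gaugeAct, B10Eq68TorusRegularity.unitsField_gaugeAct]
  have hWsu : ∀ b : PBond (F.P K) 0,
      ((gaugeActT g (unitsField (toUField U)) b : (Matrix (Fin 2) (Fin 2) ℂ)ˣ) : Matrix (Fin 2) (Fin 2) ℂ) ∈ Matrix.specialUnitaryGroup (Fin 2) ℂ := by
    intro b
    rw [← hbridge, val_unitsField]
    show ((suIncl (GaugeField.gaugeAct gJ U b) : Matrix.unitaryGroup (Fin 2) ℂ) : Matrix (Fin 2) (Fin 2) ℂ) ∈ _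
    rw [val_suIncl]
    exact (GaugeField.gaugeAct gJ U b).2
  rw [hbridge] at hInAk h15 hInAx htree htopb htower
  set W₁ : GaugeField (F.P K) 0 (Matrix (Fin 2) (Fin 2) ℂ)ˣ := gaugeActT g (unitsField (toUField U)) with hW₁
  -- the fine territory: (d) at `m = k`
  have hfine : ∀ (x : LSite (F.P K).d) (ν : Fin (F.P K).d), tlo (F.P K).L lo (K - n) ≤ x → x + e ν ≤ thi (F.P K).L hi (K - n) →
      ‖((W₁ ⟨transl 0 x, ν⟩ : (Matrix (Fin 2) (Fin 2) ℂ)ˣ) : Matrix (Fin 2) (Fin 2) ℂ) - 1‖ < s₀ := by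
    intro x ν hx hxν
    have h := htower (K - n) le_rfl x ν hx hxν
    rwa [Nat.sub_self, avgIter_zero, pull_apply] at h
  -- the cutoff one-form (§1)
  obtain ⟨A, hAsa, hAtr, hAhalf, hAnear⟩ := exists_cutoff_oneForm hη W₁ hWsu
  -- the four chart rows at a near-`1` bond
  have hrows : ∀ (x : LSite (F.P K).d) (ν : Fin (F.P K).d),
      ‖((W₁ ⟨transl 0 x, ν⟩ : (Matrix (Fin 2) (Fin 2) ℂ)ˣ) : Matrix (Fin 2) (Fin 2) ℂ) - 1‖ < s₀ →
      A x ν = logCfg η (pull W₁ 0) x ν ∧ cfgExp η A x ν = W₁ ⟨transl 0 x, ν⟩ ∧ η * ‖A x ν‖ ≤ 2 * s₀ ∧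
        ‖((W₁ ⟨transl 0 x, ν⟩ : (Matrix (Fin 2) (Fin 2) ℂ)ˣ) : Matrix (Fin 2) (Fin 2) ℂ) - 1‖ < s₀ := by
    intro x ν hb
    obtain ⟨hAx, hexp⟩ := hAnear x ν (hb.le.trans hs₀4)
    refine ⟨hAx, hexp, ?_, hb⟩
    rw [hAx]
    exact eta_mul_norm_logCfg_pull_le hη W₁ x ν (hs₀4.trans (by norm_num)) hb.le
  -- □₀ and its collar lie in the fine territory of □̃
  have hcol : Collar (cube (F.P K).L a M' ρ' (K - n) 0) (tlo (F.P K).L lo (K - n)) (thi (F.P K).L hi (K - n)) :=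
    collar_cube hL2 hρ' (Nat.zero_le _)
  have hcube : ∀ z ∈ cube (F.P K).L a M' ρ' (K - n) 0, ∀ ν : Fin (F.P K).d,
      (tlo (F.P K).L lo (K - n) ≤ z ∧ z + e ν ≤ thi (F.P K).L hi (K - n)) ∧
        (tlo (F.P K).L lo (K - n) ≤ z - e ν ∧ z - e ν + e ν ≤ thi (F.P K).L hi (K - n)) := by
    intro z hz ν
    have he : ∀ i, (0 : ℤ) ≤ e ν i ∧ e ν i ≤ 1 := fun i => by
      rw [B7Prop1Explicit.e_apply]; split_ifs <;> norm_num
    have h0 : InBox (tlo (F.P K).L lo (K - n)) (thi (F.P K).L hi (K - n)) z := hcol z hz z fun i => ⟨by linarith, by linarith⟩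
    have h1 := hcol z hz (z + e ν) fun i => ⟨by have := (he i).1; simp only [Pi.add_apply]; linarith, by have := (he i).2; simp only [Pi.add_apply]; linarith⟩
    have h2 := hcol z hz (z - e ν) fun i => ⟨by have := (he i).2; simp only [Pi.sub_apply]; linarith, by have := (he i).1; simp only [Pi.sub_apply]; linarith⟩
    refine ⟨⟨fun i => (h0 i).1, fun i => (h1 i).2⟩, fun i => (h2 i).1, ?_⟩
    rw [sub_add_cancel]
    exact fun i => (h0 i).2
  refine ⟨g, A, fun s => (gJ s).2, hWsu, hInAk, htopval, h15, hInAx, htree, htopb, htower, hAsa, hAtr, hAhalf, ?_, ?_⟩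
  · -- the fine territory of □̃
    intro x ν hx hxν
    exact hrows x ν (hfine x ν hx hxν)
  · -- □₀ and its lower collar
    intro z hz ν
    obtain ⟨⟨h0, h1⟩, h2, h3⟩ := hcube z hz ν
    exact ⟨hrows z ν (hfine z ν h0 h1), hrows (z - e ν) ν (hfine (z - e ν) ν h2 h3)⟩

/-- ★★★ **`exists_preGauge_chart` WITH THE DESCENT WINDOW DISCHARGED** from the standing smallness `10⁷L³ε₀ ≤ 1` and `l1(tHi − tLo) ≤ 10⁵` (✓`preGauge_windows`);
every conclusion VERBATIM. [cite: Balaban1985RegularSpaces, (1.33)-(1.36) p.82, (1.65)-(1.66) p.87, Thm 4 p.88; Balaban1985Variational, (2) p.278, (152) p.301; Balaban1985Averaging, Prop. 2 (52)-(54) p.26] -/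
theorem exists_preGauge_chart_of_ten7 (hnK : n < K) {ε₀ : ℝ} (hε₀ : 0 < ε₀) (hε : 10 ^ 7 * (F.L : ℝ) ^ 3 * ε₀ ≤ 1)
    {U : GaugeField (F.P K) 0 (Matrix.specialUnitaryGroup (Fin 2) ℂ)} (hU : RegPr F n K ε₀ U)
    (a : LSite (F.P K).d) (M' ρ' : ℕ) (hρ' : 1 ≤ ρ')
    (hwrap : ∀ i, tHi a M' ρ' i - tLo a ρ' i < ((F.P K).sitesPerDir (K - n) : ℤ))
    (hbox : (l1 (tHi a M' ρ' - tLo a ρ') : ℝ) ≤ 10 ^ 5)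
    (c₀ : (Matrix (Fin 2) (Fin 2) ℂ)ˣ) (hc₀ : c₀ ∈ specialUnitaryUnits (Fin 2)) :
    ∃ (g : GaugeTransf (F.P K) 0 (Matrix (Fin 2) (Fin 2) ℂ)ˣ) (A : LSite (F.P K).d → Fin (F.P K).d → Matrix (Fin 2) (Fin 2) ℂ),
      -- [R-c] the pre-gauge is special unitary, and so is the charted iterate
      (∀ s : Site (F.P K) 0, ((g s : (Matrix (Fin 2) (Fin 2) ℂ)ˣ) : Matrix (Fin 2) (Fin 2) ℂ) ∈ Matrix.specialUnitaryGroup (Fin 2) ℂ) ∧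
      (∀ b : PBond (F.P K) 0, ((gaugeActT g (unitsField (toUField U)) b : (Matrix (Fin 2) (Fin 2) ℂ)ˣ) : Matrix (Fin 2) (Fin 2) ℂ) ∈
        Matrix.specialUnitaryGroup (Fin 2) ℂ) ∧
      -- J3 (a): `W₁♯ ∈ 𝔄_k(ε₀)` on all of `ℤ³`
      InAk (F.P K).L (K - n) (((F.L : ℝ)⁻¹) ^ (K - n)) ε₀ (fun _ => (Set.univ : Set (LSite (F.P K).d)))
        (pull (gaugeActT g (unitsField (toUField U))) 0) ∧
      -- J3 (a′): the top values of `g♯` on □̃^{(k)}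
      (∀ z : LSite (F.P K).d, tLo a ρ' ≤ z → z ≤ tHi a M' ρ' →
        pullGauge g 0 ((((F.P K).L : ℤ) ^ (K - n)) • z) =
          c₀ * axialFn (avgIter (F.P K).L (pull (unitsField (toUField U)) 0) (K - n)) (tLo a ρ') z) ∧
      -- J3 (b): (1.15) between all consecutive levels at every block
      (∀ m, m < K - n → ∀ (z : LSite (F.P K).d) (r : Fin (F.P K).d → Fin (F.P K).L),
        axialFn (avgIter (F.P K).L (pull (gaugeActT g (unitsField (toUField U))) 0) (K - n - (m + 1)))
          (((F.P K).L : ℤ) • z) (((F.P K).L : ℤ) • z + boxVec (F.P K).L r) = 1) ∧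
      -- J3 (b′): `W₁♯ ∈ Ax_m(ℭ, 1)` for every `m ≤ k` and every family
      (∀ m, m ≤ K - n → ∀ Λ : ℕ → Set (LSite (F.P K).d),
        InAx (F.P K).L m Λ (1 : LSite (F.P K).d → Fin (F.P K).d → (Matrix (Fin 2) (Fin 2) ℂ)ˣ) (pull (gaugeActT g (unitsField (toUField U))) 0)) ∧
      -- J3 (c′): the top average is `1` on the tree bonds of □̃^{(k)}
      (∀ (x : LSite (F.P K).d) (ν : Fin (F.P K).d), tLo a ρ' ≤ x → x + e ν ≤ tHi a M' ρ' → lowPart ν (x - tLo a ρ') = 0 →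
        avgIter (F.P K).L (pull (gaugeActT g (unitsField (toUField U))) 0) (K - n) x ν = 1) ∧
      -- J3 (c): the top average is near `1` on □̃^{(k)}
      (∀ (x : LSite (F.P K).d) (ν : Fin (F.P K).d), tLo a ρ' ≤ x → x + e ν ≤ tHi a M' ρ' →
        ‖((avgIter (F.P K).L (pull (gaugeActT g (unitsField (toUField U))) 0) (K - n) x ν : (Matrix (Fin 2) (Fin 2) ℂ)ˣ) :
            Matrix (Fin 2) (Fin 2) ℂ) - 1‖ ≤ l1 (tHi a M' ρ' - tLo a ρ') * (2 * (2 * ε₀))) ∧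
      -- J3 (d): (1.66) at background `1` on the whole tower below □̃^{(k)}
      (∀ m, m ≤ K - n → ∀ (x : LSite (F.P K).d) (ν : Fin (F.P K).d), tlo (F.P K).L (tLo a ρ') m ≤ x → x + e ν ≤ thi (F.P K).L (tHi a M' ρ') m →
        ‖((avgIter (F.P K).L (pull (gaugeActT g (unitsField (toUField U))) 0) (K - n - m) x ν : (Matrix (Fin 2) (Fin 2) ℂ)ˣ) :
            Matrix (Fin 2) (Fin 2) ℂ) - 1‖ < 11 * ((F.P K).d : ℝ) ^ 2 * (2 * ε₀) + l1 (tHi a M' ρ' - tLo a ρ') * (2 * (2 * ε₀))) ∧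
      -- the input one-form, GLOBAL rows: Hermitian, traceless, `η‖A‖ ≤ 1∕2`
      (∀ (x : LSite (F.P K).d) (ν : Fin (F.P K).d), IsSelfAdjoint (A x ν)) ∧
      (∀ (x : LSite (F.P K).d) (ν : Fin (F.P K).d), (A x ν).trace = 0) ∧
      (∀ (x : LSite (F.P K).d) (ν : Fin (F.P K).d), ((F.L : ℝ)⁻¹) ^ (K - n) * ‖A x ν‖ ≤ 1 / 2) ∧
      -- the input one-form on the fine territory of □̃: `A = logCfg η W₁♯`, [R-a] `e^{iηA} = W₁`, the (1.36)-size, the fine near-`1`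
      (∀ (x : LSite (F.P K).d) (ν : Fin (F.P K).d), tlo (F.P K).L (tLo a ρ') (K - n) ≤ x → x + e ν ≤ thi (F.P K).L (tHi a M' ρ') (K - n) →
        A x ν = logCfg (((F.L : ℝ)⁻¹) ^ (K - n)) (pull (gaugeActT g (unitsField (toUField U))) 0) x ν ∧
        cfgExp (((F.L : ℝ)⁻¹) ^ (K - n)) A x ν = gaugeActT g (unitsField (toUField U)) ⟨transl 0 x, ν⟩ ∧
        ((F.L : ℝ)⁻¹) ^ (K - n) * ‖A x ν‖ ≤ 2 * (11 * ((F.P K).d : ℝ) ^ 2 * (2 * ε₀) + l1 (tHi a M' ρ' - tLo a ρ') * (2 * (2 * ε₀))) ∧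
        ‖((gaugeActT g (unitsField (toUField U)) ⟨transl 0 x, ν⟩ : (Matrix (Fin 2) (Fin 2) ℂ)ˣ) : Matrix (Fin 2) (Fin 2) ℂ) - 1‖ <
          11 * ((F.P K).d : ℝ) ^ 2 * (2 * ε₀) + l1 (tHi a M' ρ' - tLo a ρ') * (2 * (2 * ε₀))) ∧
      -- the same four rows on □₀ = `cube L a M′ ρ′ k 0`, for both bonds `(z, ν)` and `(z − e_ν, ν)` ([R-a] is the second row at `(z, ν)`)
      (∀ z ∈ cube (F.P K).L a M' ρ' (K - n) 0, ∀ ν : Fin (F.P K).d,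
        (A z ν = logCfg (((F.L : ℝ)⁻¹) ^ (K - n)) (pull (gaugeActT g (unitsField (toUField U))) 0) z ν ∧
          cfgExp (((F.L : ℝ)⁻¹) ^ (K - n)) A z ν = gaugeActT g (unitsField (toUField U)) ⟨transl 0 z, ν⟩ ∧
          ((F.L : ℝ)⁻¹) ^ (K - n) * ‖A z ν‖ ≤ 2 * (11 * ((F.P K).d : ℝ) ^ 2 * (2 * ε₀) + l1 (tHi a M' ρ' - tLo a ρ') * (2 * (2 * ε₀))) ∧
          ‖((gaugeActT g (unitsField (toUField U)) ⟨transl 0 z, ν⟩ : (Matrix (Fin 2) (Fin 2) ℂ)ˣ) : Matrix (Fin 2) (Fin 2) ℂ) - 1‖ <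
            11 * ((F.P K).d : ℝ) ^ 2 * (2 * ε₀) + l1 (tHi a M' ρ' - tLo a ρ') * (2 * (2 * ε₀))) ∧
        (A (z - e ν) ν = logCfg (((F.L : ℝ)⁻¹) ^ (K - n)) (pull (gaugeActT g (unitsField (toUField U))) 0) (z - e ν) ν ∧
          cfgExp (((F.L : ℝ)⁻¹) ^ (K - n)) A (z - e ν) ν = gaugeActT g (unitsField (toUField U)) ⟨transl 0 (z - e ν), ν⟩ ∧
          ((F.L : ℝ)⁻¹) ^ (K - n) * ‖A (z - e ν) ν‖ ≤ 2 * (11 * ((F.P K).d : ℝ) ^ 2 * (2 * ε₀) + l1 (tHi a M' ρ' - tLo a ρ') * (2 * (2 * ε₀))) ∧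
          ‖((gaugeActT g (unitsField (toUField U)) ⟨transl 0 (z - e ν), ν⟩ : (Matrix (Fin 2) (Fin 2) ℂ)ˣ) : Matrix (Fin 2) (Fin 2) ℂ) - 1‖ <
            11 * ((F.P K).d : ℝ) ^ 2 * (2 * ε₀) + l1 (tHi a M' ρ' - tLo a ρ') * (2 * (2 * ε₀)))) :=
  exists_preGauge_chart F hnK hε₀ hε hU a M' ρ' hρ' hwrap (preGauge_windows F (K := K) hε₀.le hε hbox).2.2 c₀ hc₀

end Chart

end Summit.QuantumFields.YangMills.Theorems.HalvingP1FlatCoreSupplierPreGauge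

end
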